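import Summits.HodgeConjecture.CorCM.GysinSurface
import HarnessLib

/-!
# COR-CM model layer, part 7a (towards M22 K-a and Fg6/Fg7): the light trace is a non-zero multiple of the
# Kronecker evaluation on the rational fundamental class

Cell `pub-hodgecm2` (COR-CM), seat `model-1`.  The model universe's trace `BettiUniverse.tr hX (2n)` is, by design,
only a coordinate functional on the top line `H^{2n}(X(ℂ); ℚ)` (light form, `BettiUniverseAxioms`).  Every duality
argument on the model (Poincaré duality for `Fact_algDuality` K-a, `Fact_weightDual`, the base change of `Fact_gysin`)
needs its comparison with the honest integration functional `b ↦ ⟨b, [X(ℂ)]⟩` (Kronecker pairing with the rational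
complex fundamental class `complexOrientationRat hX`): THIS FILE proves `tr = c • ⟨·, [X]⟩` with `c ≠ 0`
(`exists_tr_eq_smul_kronecker`) — both are non-zero linear functionals on a line (`finrank_rat_top`; `⟨·,[X]⟩ ≠ 0` because
`H_{2n} = ℚ·[X]` for the connected closed manifold `X(ℂ)` and the Kronecker map is injective over a field) — and the
resulting perfectness of the model's cup pairing `(a, b) ↦ tr(a ∪ b)` in complementary degrees
(`isPerfPair_trCup`, from the tree's `isPerfPair_cupPairing_of_field_holds`, Hatcher Prop. 3.38).
-/

noncomputable section

open CategoryTheory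
open Literature.AlgebraicTopology.SingularHomology
open Literature.AlgebraicGeometry.Motives (SchemeOver ComplexPoints IsSmoothProjective bettiCohomology)
open Literature.AlgebraicGeometry.HodgeTheory

namespace Summit.HodgeConjecture.CorCM.Model

variable {n : ℕ} {X : SchemeOver ℂ}

/-- **`⟨·, [X(ℂ)]⟩ ≠ 0` on `H^{2n}(X(ℂ); ℚ)`**: the Kronecker evaluation on the rational fundamental class is injective
on the top cohomology (`H_{2n}(X(ℂ); ℚ) = ℚ · [X(ℂ)]`, `kroneckerPairing_injective_of_field`). -/
theorem kronecker_fundamentalClass_injective (hX : IsSmoothProjective n X) :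
    Function.Injective ((kroneckerPairing ℚ ℚ (ComplexPoints X) (2 * n)).flip
      (complexOrientationRat hX).fundamentalClass) := by
  letI := hX.chartedSpace
  haveI := Literature.AlgebraicGeometry.Motives.ComplexPoints.compactSpace_of_isSmoothProjective hX
  haveI := Literature.AlgebraicGeometry.Motives.ComplexPoints.t2Space_of_isSmoothProjective hX
  haveI := connectedSpace_complexPoints hX
  rw [← LinearMap.ker_eq_bot, LinearMap.ker_eq_bot']
  intro b hb
  rw [LinearMap.flip_apply] at hb
  apply kroneckerPairing_injective_of_field ℚ (ComplexPoints X) (2 * n)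
  refine LinearMap.ext fun z ↦ ?_
  obtain ⟨c, rfl⟩ := exists_eq_smul_fundamentalClass_of_connectedSpace (complexOrientationRat hX) z
  rw [map_smul, hb, smul_zero, map_zero, LinearMap.zero_apply]

/-- **`tr = c • ⟨·, [X(ℂ)]⟩`, `c ≠ 0`**: the light trace of the model universe on `H^{2n}(X(ℂ); ℚ)` is a non-zero rational
multiple of the Kronecker evaluation on the rational complex fundamental class. -/
theorem exists_tr_eq_smul_kronecker (hX : IsSmoothProjective n X) :
    ∃ c : ℚ, c ≠ 0 ∧ BettiUniverse.tr hX (2 * n) =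
      c • (kroneckerPairing ℚ ℚ (ComplexPoints X) (2 * n)).flip (complexOrientationRat hX).fundamentalClass := by
  have h1 : Module.finrank ℚ (bettiCohomology X (2 * n)) = 1 := finrank_rat_top hX
  have hκ : (kroneckerPairing ℚ ℚ (ComplexPoints X) (2 * n)).flip (complexOrientationRat hX).fundamentalClass ≠ 0 := by
    intro h0
    have hinj := kronecker_fundamentalClass_injective hX
    rw [h0] at hinj
    have hb := (BettiUniverse.lineBasis hX (2 * n) h1).ne_zero 0
    exact hb (hinj (by rw [LinearMap.zero_apply, LinearMap.zero_apply]))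
  obtain ⟨c, hc⟩ := exists_eq_smul_of_finrank_eq_one' h1 (BettiUniverse.tr hX (2 * n)) _ hκ
  refine ⟨c, ?_, hc⟩
  rintro rfl
  rw [zero_smul] at hc
  exact BettiUniverse.tr_ne_zero hX h1 hc

/-- **The model's cup pairing `(a, b) ↦ tr(a ∪ b)` in complementary degrees is perfect** (Poincaré duality over `ℚ`,
Hatcher Prop. 3.38: the tree's `isPerfPair_cupPairing_of_field_holds`, rescaled by `exists_tr_eq_smul_kronecker`). -/
theorem isPerfPair_trCup (hX : IsSmoothProjective n X) {p q : ℕ} (h : p + q = 2 * n) :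
    ((cupProduct h : bettiCohomology X p →ₗ[ℚ] bettiCohomology X q →ₗ[ℚ] bettiCohomology X (2 * n)).compr₂
      (BettiUniverse.tr hX (2 * n))).IsPerfPair := by
  letI := hX.chartedSpace
  haveI := Literature.AlgebraicGeometry.Motives.ComplexPoints.compactSpace_of_isSmoothProjective hX
  haveI := Literature.AlgebraicGeometry.Motives.ComplexPoints.t2Space_of_isSmoothProjective hX
  obtain ⟨c, hc, htr⟩ := exists_tr_eq_smul_kronecker hX
  have hP := isPerfPair_cupPairing_of_field_holds (μ := complexOrientationRat hX) (h := h)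
  unfold isPerfPair_cupPairing_of_field at hP
  have heq : (cupProduct h : bettiCohomology X p →ₗ[ℚ] bettiCohomology X q →ₗ[ℚ] bettiCohomology X (2 * n)).compr₂
      (BettiUniverse.tr hX (2 * n)) = c • cupPairing (complexOrientationRat hX) h := by
    refine LinearMap.ext fun a ↦ LinearMap.ext fun b ↦ ?_
    rw [LinearMap.compr₂_apply, htr, LinearMap.smul_apply, LinearMap.smul_apply, LinearMap.smul_apply,
      cupPairing_apply, LinearMap.flip_apply]
  rw [heq]
  haveI : FiniteDimensional ℚ (bettiCohomology X p) := BettiUniverse.finite hX p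
  have hinjL : Function.Injective (cupPairing (complexOrientationRat hX) h) := hP.bijective_left.1
  have hinjR : Function.Injective (cupPairing (complexOrientationRat hX) h).flip := hP.bijective_right.1
  refine LinearMap.IsPerfPair.of_injective ?_ ?_
  · intro a a' haa
    apply hinjL
    have h2 := congrArg (fun f ↦ c⁻¹ • f) haa
    simpa only [LinearMap.smul_apply, smul_smul, inv_mul_cancel₀ hc, one_smul] using h2
  · intro b b' hbb
    apply hinjR
    have h2 := congrArg (fun f ↦ c⁻¹ • f) hbb
    refine LinearMap.ext fun a ↦ ?_
    have h3 := LinearMap.congr_fun h2 a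
    simp only [LinearMap.smul_apply, LinearMap.flip_apply, smul_eq_mul, ← mul_assoc, inv_mul_cancel₀ hc,
      one_mul] at h3
    rw [LinearMap.flip_apply, LinearMap.flip_apply]
    exact h3
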